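/-
COR-CM (cell pub-hodgecm2, stage 2 of the Hodge ladder) — count-neutral KERNEL COMBINATORICS «the sheared dihedral family», part VIII: base change along
the slice datum is the model's motion (seat prover-pub-hodgecm2-b23-g52-0, binder prover b23, gen 52; claim «SYLOW TRANSFER XII + THE SHEARED DIHEDRAL
FAMILY», HOME/INBOX.md l.23708).  PORT of gen 44ʼs `Census/QuarticInversionBaseChange.lean` (this lineage): theorems only, on part VII
(`Census/ShearedDihedralSliceDictionary.lean`) and part V (`Census/ShearedDihedralModel.lean`: `twS`) BY NAME; no `decide` beyond closed identities in
`ZMod 2`, no certificate, no named fact, no `sorry`.  `Interfaces.lean` (C1), every E term, B01, `Transposition/*`, `PortJoin/*`, `D2Bridge/*` untouched.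
HONEST FRAMING: `HC_CM` is NOT proved, here or anywhere in the tree; nothing here is a period, a count of record or a headline.
-/
import Summits.HodgeConjecture.CorCM.Census.ShearedDihedralSliceDictionary

/-!
# The sheared dihedral family, VIII: base change along a slice datum is the modelʼs motion — `ty (Ψ·t⁻¹) = twS (ty Ψ)`

Along a slice datum of square class `ζ` (`ι : ℤ/2 × B ↪ G`, `y` inverting with `y² = ι(ζ,0)`, `t` a centralising INVOLUTION, `y t = c t y`), base
change of abstract CM types reads on the quadruple of labels as
* **`ty (Ψ·(ι a)⁻¹) = twH₄ a (ty Ψ)`** and **`ty (Ψ·y⁻¹) = twY ζ (ty Ψ)`** — VERBATIM gen 44, exported bundled with the next one as `ty_rt_gens`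
  (and `typeOf_tw_gens`), since the single statements are column-generic;
* **`ty (Ψ·t⁻¹) = twS (ty Ψ) = ((ψ₂, ψ₃+1), (ψ₀, ψ₁+1))`** (`ty_rt_t`) — part Vʼs motion of the involution `s` (gen 44ʼs `twT` had `(ψ₀+1, ψ₁)` in the
  second pair: `t² = c` there, `t² = 1` here, and `t y t = c y` here);
* `ty (Ψ·c) = twH₄ (1,0) (ty Ψ)`; equivalently `typeOf (twH₄ a Θ) = (typeOf Θ)·(ι a)⁻¹`, `typeOf (twY ζ Θ) = (typeOf Θ)·y⁻¹`, **`typeOf (twS Θ) = (typeOf Θ)·t⁻¹`**.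
So part Vʼs relations (`twS² = id`, `twY twS = twH₄ c twS twY`, …) ARE the relations of `X_n` read through Pohlmannʼs dictionary [Pohlmann1968, Thm 1].  All [folklore].

## References
* [Pohlmann1968] H. Pohlmann, Algebraic cycles on abelian varieties of complex multiplication type, Ann. of Math. 88 (1968), Thm 1.
-/

namespace Summit.HodgeConjecture.CorCM.Census.ShearedDihedral

open Summit.HodgeConjecture.CorCM.Census.QuarticInversion (Ty₄ cst twH₄ twY)

open Finset
open Summit.HodgeConjecture.CorCM.Prior.AllgGroup.RfwfAllgGroup
open Summit.HodgeConjecture.CorCM.Census.BlockParity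
open Summit.HodgeConjecture.CorCM.Census.OddSliceFacesModel
open Summit.HodgeConjecture.CorCM.Census.DicyclicTwist (Ty₂ rev twH)

noncomputable section

variable {G : Type*} [Group G] [Fintype G] [DecidableEq G] {c : G}
variable {A : Type} [AddCommGroup A] [Fintype A] [DecidableEq A] {ζ : ZMod 2}
variable (D : SliceDatum G c A ζ)

/-- Two elements of `ℤ/2` that vanish together are equal. [folklore] -/
private theorem zmod2_eq_of_iff' : ∀ {u v : ZMod 2}, (u = 0 ↔ v = 0) → u = v := by decide

/-- `u = e ↔ u + e = 0` in `ℤ/2`. [folklore] -/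
private theorem eq_iff_add_eq_zero' : ∀ u e : ZMod 2, u = e ↔ u + e = 0 := by decide

/-! ## §3 Base change is the model's motion -/

/-- `¬ u = 0 ↔ u + 1 = 0` in `ℤ/2`. [folklore] -/
private theorem not_eq_zero_iff_add_one : ∀ u : ZMod 2, ¬ u = 0 ↔ u + 1 = 0 := by decide

omit [Fintype A] [DecidableEq A] in
/-- Base change along `ι a` is the diagonal twist: `ty (Ψ·(ι a)⁻¹) = twH₄ a (ty Ψ)` (verbatim gen 44; private — the public form is the
bundle `ty_rt_gens` below, the single statement being column-generic). [folklore] -/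
private theorem ty_rt_ι (a : ZMod 2 × A) (Ψ : CMF G c) : ty D (rt c (D.ι a) Ψ) = twH₄ A a (ty D Ψ) := by
  have e1 : ∀ s : A, D.ι (0, s) * D.ι a = D.ι (a.1, s + a.2) := fun s => ι0_mul_ι D s a
  refine Prod.ext (Prod.ext (funext fun s => zmod2_eq_of_iff' ?_) (funext fun s => zmod2_eq_of_iff' ?_))
    (Prod.ext (funext fun s => zmod2_eq_of_iff' ?_) (funext fun s => zmod2_eq_of_iff' ?_))
  · show (ty D (rt c (D.ι a) Ψ)).1.1 s = 0 ↔ (ty D Ψ).1.1 (s + a.2) + a.1 = 0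
    rw [← ι_mem_iff, mem_rt, e1, ι_mem_iff]
    exact eq_iff_add_eq_zero' _ _
  · show (ty D (rt c (D.ι a) Ψ)).1.2 s = 0 ↔ (ty D Ψ).1.2 (s + a.2) + a.1 = 0
    rw [← yι_mem_iff, mem_rt, mul_assoc, e1, yι_mem_iff]
    exact eq_iff_add_eq_zero' _ _
  · show (ty D (rt c (D.ι a) Ψ)).2.1 s = 0 ↔ (ty D Ψ).2.1 (s + a.2) + a.1 = 0
    rw [← tι_mem_iff, mem_rt, mul_assoc, e1, tι_mem_iff]
    exact eq_iff_add_eq_zero' _ _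
  · show (ty D (rt c (D.ι a) Ψ)).2.2 s = 0 ↔ (ty D Ψ).2.2 (s + a.2) + a.1 = 0
    rw [← tyι_mem_iff, mem_rt, mul_assoc, mul_assoc, e1, tyι_mem_iff]
    exact eq_iff_add_eq_zero' _ _

omit [Fintype A] [DecidableEq A] in
/-- Base change along `y` is the swap-twist of square class `ζ`: `ty (Ψ·y⁻¹) = twY ζ (ty Ψ)` (verbatim gen 44; private, see `ty_rt_gens`).
[folklore] -/
private theorem ty_rt_y (Ψ : CMF G c) : ty D (rt c D.y Ψ) = twY A ζ (ty D Ψ) := by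
  have e1 : ∀ s : A, D.ι (0, s) * D.y = D.y * D.ι (0, -s) := fun s => by
    rw [ι_mul_y, Prod.neg_mk, neg_zero]
  have e2 : ∀ s : A, D.y * D.ι (0, s) * D.y = D.ι (ζ, -s) := fun s => by
    rw [mul_assoc, e1, ← mul_assoc, D.y_mul_y, ← D.map_add, Prod.mk_add_mk, add_zero, zero_add]
  refine Prod.ext (Prod.ext (funext fun s => zmod2_eq_of_iff' ?_) (funext fun s => zmod2_eq_of_iff' ?_))
    (Prod.ext (funext fun s => zmod2_eq_of_iff' ?_) (funext fun s => zmod2_eq_of_iff' ?_))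
  · show (ty D (rt c D.y Ψ)).1.1 s = 0 ↔ (ty D Ψ).1.2 (-s) = 0
    rw [← ι_mem_iff, mem_rt, e1, yι_mem_iff]
  · show (ty D (rt c D.y Ψ)).1.2 s = 0 ↔ (ty D Ψ).1.1 (-s) + ζ = 0
    rw [← yι_mem_iff, mem_rt, e2, ι_mem_iff]
    exact eq_iff_add_eq_zero' _ _
  · show (ty D (rt c D.y Ψ)).2.1 s = 0 ↔ (ty D Ψ).2.2 (-s) = 0
    rw [← tι_mem_iff, mem_rt, mul_assoc, e1, tyι_mem_iff]
  · show (ty D (rt c D.y Ψ)).2.2 s = 0 ↔ (ty D Ψ).2.1 (-s) + ζ = 0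
    rw [← tyι_mem_iff, mem_rt, mul_assoc, e2, tι_mem_iff]
    exact eq_iff_add_eq_zero' _ _

omit [Fintype A] [DecidableEq A] in
/-- **Base change along the involution `t`**: `ty (Ψ·t⁻¹) = twS (ty Ψ) = ((ψ₂, ψ₃ + 1), (ψ₀, ψ₁ + 1))`. [folklore] -/
theorem ty_rt_t (Ψ : CMF G c) : ty D (rt c D.t Ψ) = twS A (ty D Ψ) := by
  have hc : ∀ g : G, c * g ∈ Ψ.1 ↔ g ∉ Ψ.1 := fun g => by have h := Ψ.2 g; tauto
  refine Prod.ext (Prod.ext (funext fun s => zmod2_eq_of_iff' ?_) (funext fun s => zmod2_eq_of_iff' ?_))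
    (Prod.ext (funext fun s => zmod2_eq_of_iff' ?_) (funext fun s => zmod2_eq_of_iff' ?_))
  · show (ty D (rt c D.t Ψ)).1.1 s = 0 ↔ (ty D Ψ).2.1 s = 0
    rw [← ι_mem_iff, mem_rt, ι_mul_t, tι_mem_iff]
  · show (ty D (rt c D.t Ψ)).1.2 s = 0 ↔ (ty D Ψ).2.2 s + 1 = 0
    rw [← yι_mem_iff, mem_rt, mul_assoc, ι_mul_t, ← mul_assoc, D.y_mul_t, mul_assoc, mul_assoc, hc, tyι_mem_iff]
    exact not_eq_zero_iff_add_one _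
  · show (ty D (rt c D.t Ψ)).2.1 s = 0 ↔ (ty D Ψ).1.1 s = 0
    rw [← tι_mem_iff, mem_rt, mul_assoc, ι_mul_t, ← mul_assoc, D.t_mul_t, one_mul, ι_mem_iff]
  · show (ty D (rt c D.t Ψ)).2.2 s = 0 ↔ (ty D Ψ).1.2 s + 1 = 0
    rw [← tyι_mem_iff, mem_rt, mul_assoc, mul_assoc, ι_mul_t, ← mul_assoc, ← mul_assoc, t_mul_y_mul_t, mul_assoc, hc, yι_mem_iff]
    exact not_eq_zero_iff_add_one _

omit [Fintype A] [DecidableEq A] in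
/-- **Base change along the three kinds of generators** `ι a`, `y`, `t` of `G` (from a slice datum): `ty (Ψ·(ι a)⁻¹) = twH₄ a (ty Ψ)`,
`ty (Ψ·y⁻¹) = twY ζ (ty Ψ)`, `ty (Ψ·t⁻¹) = twS (ty Ψ)` — the labelling is equivariant for the model motions of parts V/VI. [folklore] -/
theorem ty_rt_gens :
    (∀ (a : ZMod 2 × A) (Ψ : CMF G c), ty D (rt c (D.ι a) Ψ) = twH₄ A a (ty D Ψ)) ∧
      (∀ Ψ : CMF G c, ty D (rt c D.y Ψ) = twY A ζ (ty D Ψ)) ∧ ∀ Ψ : CMF G c, ty D (rt c D.t Ψ) = twS A (ty D Ψ) :=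
  ⟨ty_rt_ι D, ty_rt_y D, ty_rt_t D⟩

omit [DecidableEq A] in
/-- Types of diagonally moved labels: `typeOf (twH₄ a Θ) = (typeOf Θ)·(ι a)⁻¹` (private, see `typeOf_tw_gens`). [folklore] -/
private theorem typeOf_twH₄ (a : ZMod 2 × A) (Θ : Ty₄ A) : typeOf D (twH₄ A a Θ) = rt c (D.ι a) (typeOf D Θ) := by
  apply ty_injective D
  rw [ty_typeOf, ty_rt_ι, ty_typeOf]

omit [DecidableEq A] in
/-- Types of `y`-moved labels: `typeOf (twY ζ Θ) = (typeOf Θ)·y⁻¹` (private, see `typeOf_tw_gens`). [folklore] -/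
private theorem typeOf_twY (Θ : Ty₄ A) : typeOf D (twY A ζ Θ) = rt c D.y (typeOf D Θ) := by
  apply ty_injective D
  rw [ty_typeOf, ty_rt_y, ty_typeOf]

omit [DecidableEq A] in
/-- Types of `s`-moved labels: `typeOf (twS Θ) = (typeOf Θ)·t⁻¹`. [folklore] -/
theorem typeOf_twS (Θ : Ty₄ A) : typeOf D (twS A Θ) = rt c D.t (typeOf D Θ) := by
  apply ty_injective D
  rw [ty_typeOf, ty_rt_t, ty_typeOf]

omit [DecidableEq A] in
/-- **Types of moved labels, all three motions**: `typeOf (twH₄ a Θ) = (typeOf Θ)·(ι a)⁻¹`, `typeOf (twY ζ Θ) = (typeOf Θ)·y⁻¹`,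
`typeOf (twS Θ) = (typeOf Θ)·t⁻¹`. [folklore] -/
theorem typeOf_tw_gens :
    (∀ (a : ZMod 2 × A) (Θ : Ty₄ A), typeOf D (twH₄ A a Θ) = rt c (D.ι a) (typeOf D Θ)) ∧
      (∀ Θ : Ty₄ A, typeOf D (twY A ζ Θ) = rt c D.y (typeOf D Θ)) ∧ ∀ Θ : Ty₄ A, typeOf D (twS A Θ) = rt c D.t (typeOf D Θ) :=
  ⟨typeOf_twH₄ D, typeOf_twY D, typeOf_twS D⟩

end

end Summit.HodgeConjecture.CorCM.Census.ShearedDihedral
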